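/-
Copyright (c) 2026 the pub-hodgecm-mathlib formalisation cell (harness21).  Prover seat hodgecm-mathlib-K2E4-p10 (g10), Track B «K2-LIT»,
#184♮ = hLiu418 = `stmt-HodgeConjecture-24832`; socket #41, KIND 1 — (iv-G-a) GROWTH OF THE UNIVERSAL CONTINUATION WITNESS `Φ` of the rank-one confluent letter
(K1a desk K2Liu-p01 (g11) WORD #11 (3): (iv) `hAcwb` scalar type; consumer K2Liu-p03 (g8) ★ p864498 (iv)).  THEOREMS ONLY (no `def`, no `instance`, no notation, no named-fact
hypothesis, no `sorry`).
-/
import Summits.HodgeConjecture.HodgeConjecture.Theorems.K2LiuHermTwoEtaRankOneGrowth     -- ★ p863763: `norm_jIntegral_le_of_nonneg`, `norm_jIntegral_le_of_nonpos`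
import Mathlib.Analysis.SpecialFunctions.Gamma.BohrMollerup                          -- `Real.convexOn_Gamma`
import Mathlib.Analysis.SpecialFunctions.Gamma.Beta                                  -- `Complex.differentiable_one_div_Gamma`
import HarnessLib

/-!
# Crux `HLiu418`, socket #41, KIND 1 — (iv-G-a) `K2LiuHermTwoEtaRankOneWitnessGrowth`: polynomial growth, uniform near `z` and in the weight `p` and index `t`, of ANY witness
# `Φ` of ★ p863550 `exists_continuation_jIntegral_param` (its letters (b) agreement and (c) recursion BY VALUE)

Cell `hodgecm-mathlib`, crux item hLiu418 = `stmt-HodgeConjecture-24832` (helper lane `--supports … --as helper`, count-neutral), route of record `HCCMUnconditional`;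
squad K2 ∕ K2Liu, road `K2_Liu`, socket #41, KIND 1 a♮; K1a desk K2Liu-p01 (g11) (deputy: this seat).  The scalar-type continued archimedean letter of ★ p864004
`K2LiuArchTwistedScalarLettersExplicit` is an explicit product whose only non-elementary factor is `Φ (1 + k∕2) (1 − k∕2) p s`, `Φ` the depth-`N` witness of ★ p863550
(`Φ α₀ β₀ p s = Γ(β₀+s−1)⁻¹·J_{p,t}(α₀+s, β₀+s)` on `{1 < re(β₀+s)}`, `J_{p,t}(α, β) = ∫₀^∞ e^{−pr}(r+2t)^{α−2}r^{β−2}dr`; recursion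
`Φ α₀ β₀ = p·Φ α₀ (β₀+1) − (α₀+s−2)·Φ (α₀−1) (β₀+1)` on `{1 − N < re(β₀+s)}`).  THIS FILE bounds ANY such `Φ` near every `z` of the strip by a POLYNOMIAL ENVELOPE in
`p` and `t`, uniformly: `‖Φ α₀ β₀ p s‖ ≤ C·E(p,t)^K` for `dist s z < r`, `E(p,t) := (1+p)(1+p⁻¹)·(1+t)(1+t⁻¹)` (the NEGATIVE powers of `p` and `t` are real: ★ p863763's bounds
carry `(1∕p)^{b+1}` and `(2t)^{a}` with `a = re α − 2` of either sign — K2Liu-p03 (g8) 2026-09-05T02:11:05Z), with `C, K, r` depending on `(α₀, β₀, z, N)` ONLY.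
* §1 envelope bookkeeping: `one_le_envFactor`, `rpow_le_envFactor_pow` (`q^x ≤ ((1+q)(1+q⁻¹))^{⌈X⌉}` for `|x| ≤ X`), `Gamma_le_add_of_mem_Icc` (convexity ★ `Real.convexOn_Gamma`);
* §2 `norm_jIntegral_le_env` — ★ p863763's two branches under ONE envelope, constants in `(A, u, v)` with `|re α − 2| ≤ A`, `re β − 1 ∈ [u, v] ⊂ (0, ∞)`;
* §3 **`norm_witness_le`** — unrolling (c) to the half-plane of (b) (induction on the depth), `Γ(β₀+s−1)⁻¹` bounded on the closed ball (entire).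
[Shimura1982, §3 (3.6)–(3.8), Thm. 3.1], [Shimura1997, §16.4].
HONEST LABEL.  Elementary real∕complex estimates, count-neutral; they close no socket: `HC_CM` is proved only modulo the 7 printed citations (2 remaining named inputs:
hLiu418 = `stmt-HodgeConjecture-24832`, h413 = `stmt-HodgeConjecture-24833`) until rung 0 closes.
-/

set_option autoImplicit false
set_option linter.dupNamespace false -- the mandated namespace repeats `HodgeConjecture.HodgeConjecture`

noncomputable section

open Complex MeasureTheory Set Filter Metric

namespace Summit.HodgeConjecture.HodgeConjecture.Cruxes.HLiu418.K2LiuHermTwoEtaRankOneWitnessGrowth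

open Summit.HodgeConjecture.HodgeConjecture.Cruxes.HLiu418.K2LiuHermTwoEtaRankOneGrowth (norm_jIntegral_le_of_nonneg norm_jIntegral_le_of_nonpos)

/-! ## §1 Envelope bookkeeping -/

/-- `1 ≤ (1+q)(1+q⁻¹)` for `q > 0`. [folklore] -/
theorem one_le_envFactor {q : ℝ} (hq : 0 < q) : 1 ≤ (1 + q) * (1 + q⁻¹) := by
  have h1 : 1 ≤ 1 + q := by linarith
  have h2 : 1 ≤ 1 + q⁻¹ := by linarith [inv_pos.2 hq]
  nlinarith

/-- **`q^x ≤ ((1+q)(1+q⁻¹))^{⌈X⌉}` for `q > 0`, `|x| ≤ X`** — positive and negative real powers under one envelope. [folklore] -/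
theorem rpow_le_envFactor_pow {q x X : ℝ} (hq : 0 < q) (hx : |x| ≤ X) : q ^ x ≤ ((1 + q) * (1 + q⁻¹)) ^ ⌈X⌉₊ := by
  have hF := one_le_envFactor hq
  have hXc : X ≤ (⌈X⌉₊ : ℝ) := Nat.le_ceil X
  rw [← Real.rpow_natCast]
  rcases le_or_gt 0 x with h0 | h0
  · -- `x ≥ 0`: `q ≤ 1 + q ≤ F`
    have hxX : x ≤ X := (le_abs_self x).trans hx
    calc q ^ x ≤ ((1 + q) * (1 + q⁻¹)) ^ x :=
          Real.rpow_le_rpow hq.le (by nlinarith [inv_pos.2 hq]) h0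
      _ ≤ ((1 + q) * (1 + q⁻¹)) ^ ((⌈X⌉₊ : ℕ) : ℝ) := Real.rpow_le_rpow_of_exponent_le hF (hxX.trans hXc)
  · -- `x < 0`: `q^x = (q⁻¹)^{−x}`, `q⁻¹ ≤ 1 + q⁻¹ ≤ F`
    have hxX : -x ≤ X := (neg_le_abs x).trans hx
    have e : q ^ x = q⁻¹ ^ (-x) := by rw [Real.inv_rpow hq.le, Real.rpow_neg hq.le, inv_inv]
    rw [e]
    calc q⁻¹ ^ (-x) ≤ ((1 + q) * (1 + q⁻¹)) ^ (-x) :=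
          Real.rpow_le_rpow (inv_pos.2 hq).le (by nlinarith [inv_pos.2 hq]) (by linarith)
      _ ≤ ((1 + q) * (1 + q⁻¹)) ^ ((⌈X⌉₊ : ℕ) : ℝ) := Real.rpow_le_rpow_of_exponent_le hF (hxX.trans hXc)

/-- `Γ` on a compact subinterval of `(0, ∞)` is bounded by the sum of its endpoint values (convexity, ★ `Real.convexOn_Gamma`). [folklore] -/
theorem Gamma_le_add_of_mem_Icc {u v x : ℝ} (hu : 0 < u) (hx : x ∈ Icc u v) : Real.Gamma x ≤ Real.Gamma u + Real.Gamma v := by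
  have huv : u ≤ v := hx.1.trans hx.2
  have hv : 0 < v := hu.trans_le huv
  have hseg : x ∈ segment ℝ u v := by rw [segment_eq_Icc huv]; exact hx
  have h := Real.convexOn_Gamma.le_on_segment hu hv hseg
  have hΓu := (Real.Gamma_pos_of_pos hu).le
  have hΓv := (Real.Gamma_pos_of_pos hv).le
  rcases le_total (Real.Gamma u) (Real.Gamma v) with h1 | h1
  · rw [max_eq_right h1] at h; linarith
  · rw [max_eq_left h1] at h; linarith

/-! ## §2 The rank-one letter `J_{p,t}(α, β)` under one envelope -/

/-- **ONE ENVELOPE FOR ★ p863763's TWO BRANCHES**: for `p, t > 0`, `|re α − 2| ≤ A` and `re β − 1 ∈ [u, v]` with `0 < u`: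
`‖J_{p,t}(α, β)‖ ≤ (2^{⌈A⌉}(Γ u + Γ(A+v)) + 4^{⌈A⌉}(Γ u + Γ v))·E(p,t)^{⌈A+v⌉ + ⌈A⌉ + ⌈v⌉}`, `E(p,t) = (1+p)(1+p⁻¹)(1+t)(1+t⁻¹)`.
[cite: Shimura1982, §3 (3.6)–(3.8)] -/
theorem norm_jIntegral_le_env {p t : ℝ} (hp : 0 < p) (ht : 0 < t) {α β : ℂ} {A u v : ℝ} (hA : |(α - 2).re| ≤ A) (hu : 0 < u)
    (hbu : u ≤ (β - 2).re + 1) (hbv : (β - 2).re + 1 ≤ v) :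
    ‖∫ r in Ioi (0 : ℝ), cexp (-((p * r : ℝ) : ℂ)) * ((((r + 2 * t : ℝ)) : ℂ) ^ (α - 2) * ((r : ℝ) : ℂ) ^ (β - 2))‖ ≤
      ((2 : ℝ) ^ ⌈A⌉₊ * (Real.Gamma u + Real.Gamma (A + v)) + (4 : ℝ) ^ ⌈A⌉₊ * (Real.Gamma u + Real.Gamma v)) *
        (((1 + p) * (1 + p⁻¹)) * ((1 + t) * (1 + t⁻¹))) ^ (⌈A + v⌉₊ + ⌈A⌉₊ + ⌈v⌉₊) := by
  set a : ℝ := (α - 2).re with ha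
  set b : ℝ := (β - 2).re with hb
  set Fp : ℝ := (1 + p) * (1 + p⁻¹) with hFp
  set Ft : ℝ := (1 + t) * (1 + t⁻¹) with hFt
  have hA0 : 0 ≤ A := (abs_nonneg _).trans hA
  have hv : 0 < v := hu.trans_le (hbu.trans hbv)
  have hb1 : -1 < b := by linarith
  have hFp1 : 1 ≤ Fp := one_le_envFactor hp
  have hFt1 : 1 ≤ Ft := one_le_envFactor ht
  have hFp0 : 0 < Fp := by linarith
  have hFt0 : 0 < Ft := by linarith
  have hE1 : 1 ≤ Fp * Ft := by nlinarith
  have hE0 : 0 < Fp * Ft := by positivity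
  have hFpE : Fp ≤ Fp * Ft := le_mul_of_one_le_right (by linarith) hFt1
  have hFtE : Ft ≤ Fp * Ft := le_mul_of_one_le_left (by linarith) hFp1
  -- Γ-values on the ball
  have hΓu := (Real.Gamma_pos_of_pos hu).le
  have hΓv := (Real.Gamma_pos_of_pos hv).le
  have hΓAv := (Real.Gamma_pos_of_pos (by linarith : 0 < A + v)).le
  have hΓ1 : Real.Gamma (b + 1) ≤ Real.Gamma u + Real.Gamma v := Gamma_le_add_of_mem_Icc hu ⟨hbu, hbv⟩
  -- the powers
  have h2a : (2 : ℝ) ^ a ≤ (2 : ℝ) ^ ⌈A⌉₊ := by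
    rw [← Real.rpow_natCast]
    exact Real.rpow_le_rpow_of_exponent_le (by norm_num) (((le_abs_self a).trans hA).trans (Nat.le_ceil A))
  have hpinv : ∀ {x X : ℝ}, |x| ≤ X → (1 / p) ^ x ≤ (Fp * Ft) ^ ⌈X⌉₊ := fun {x X} hx => by
    have h := rpow_le_envFactor_pow (inv_pos.2 hp) hx
    rw [inv_inv, mul_comm (1 + p⁻¹)] at h
    rw [one_div]
    exact h.trans (pow_le_pow_left₀ hFp0.le hFpE _)
  have hta : (2 * t) ^ a ≤ (2 : ℝ) ^ ⌈A⌉₊ * (Fp * Ft) ^ ⌈A⌉₊ := by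
    rw [Real.mul_rpow (by norm_num) ht.le]
    exact mul_le_mul h2a ((rpow_le_envFactor_pow ht hA).trans (pow_le_pow_left₀ hFt0.le hFtE _)) (Real.rpow_nonneg ht.le a) (by positivity)
  have hb1v : |b + 1| ≤ v := by rw [abs_of_pos (by linarith)]; exact hbv
  have hpb : (1 / p) ^ (b + 1) ≤ (Fp * Ft) ^ ⌈v⌉₊ := hpinv hb1v
  -- exponent raise: `E^i ≤ E^K` for `i ≤ K`
  set K : ℕ := ⌈A + v⌉₊ + ⌈A⌉₊ + ⌈v⌉₊ with hK
  have hraise : ∀ {i : ℕ}, i ≤ K → (Fp * Ft) ^ i ≤ (Fp * Ft) ^ K := fun hi => pow_le_pow_right₀ hE1 hi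
  -- the second summand, common to both branches (pre-multiplied by `2^⌈A⌉`)
  have hΓb0 : 0 ≤ Real.Gamma (b + 1) := (Real.Gamma_pos_of_pos (by linarith)).le
  have hT2 : (2 : ℝ) ^ ⌈A⌉₊ * ((2 * t) ^ a * ((1 / p) ^ (b + 1) * Real.Gamma (b + 1))) ≤ ((4 : ℝ) ^ ⌈A⌉₊ * (Real.Gamma u + Real.Gamma v)) * (Fp * Ft) ^ K := by
    have h4 : (4 : ℝ) ^ ⌈A⌉₊ = (2 : ℝ) ^ ⌈A⌉₊ * (2 : ℝ) ^ ⌈A⌉₊ := by rw [← mul_pow]; norm_num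
    calc (2 : ℝ) ^ ⌈A⌉₊ * ((2 * t) ^ a * ((1 / p) ^ (b + 1) * Real.Gamma (b + 1)))
        ≤ (2 : ℝ) ^ ⌈A⌉₊ * (((2 : ℝ) ^ ⌈A⌉₊ * (Fp * Ft) ^ ⌈A⌉₊) * ((Fp * Ft) ^ ⌈v⌉₊ * (Real.Gamma u + Real.Gamma v))) :=
          mul_le_mul_of_nonneg_left (mul_le_mul hta (mul_le_mul hpb hΓ1 hΓb0 (by positivity)) (mul_nonneg (by positivity) hΓb0) (by positivity))
            (by positivity)
      _ = (4 : ℝ) ^ ⌈A⌉₊ * (Real.Gamma u + Real.Gamma v) * ((Fp * Ft) ^ (⌈A⌉₊ + ⌈v⌉₊)) := by rw [pow_add, h4]; ring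
      _ ≤ (4 : ℝ) ^ ⌈A⌉₊ * (Real.Gamma u + Real.Gamma v) * (Fp * Ft) ^ K :=
          mul_le_mul_of_nonneg_left (hraise (by rw [hK]; omega)) (by positivity)
  have h2A1 : (1 : ℝ) ≤ (2 : ℝ) ^ ⌈A⌉₊ := one_le_pow₀ (by norm_num)
  have hT2' : (2 * t) ^ a * ((1 / p) ^ (b + 1) * Real.Gamma (b + 1)) ≤ ((4 : ℝ) ^ ⌈A⌉₊ * (Real.Gamma u + Real.Gamma v)) * (Fp * Ft) ^ K := by
    have h0 : 0 ≤ (2 * t) ^ a * ((1 / p) ^ (b + 1) * Real.Gamma (b + 1)) := mul_nonneg (Real.rpow_nonneg (by positivity) a) (mul_nonneg (by positivity) hΓb0)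
    exact (le_mul_of_one_le_left h0 h2A1).trans hT2
  rcases le_or_gt 0 a with ha0 | ha0
  · -- branch `re α ≥ 2`
    have hab : |a + b + 1| ≤ A + v := by
      rw [abs_of_nonneg (by linarith)]; linarith [(le_abs_self a).trans hA]
    have hΓ2 : Real.Gamma (a + b + 1) ≤ Real.Gamma u + Real.Gamma (A + v) :=
      Gamma_le_add_of_mem_Icc hu ⟨by linarith, by linarith [(le_abs_self a).trans hA]⟩
    have hΓab0 : 0 ≤ Real.Gamma (a + b + 1) := (Real.Gamma_pos_of_pos (by linarith)).le
    have hT1 : (1 / p) ^ (a + b + 1) * Real.Gamma (a + b + 1) ≤ (Fp * Ft) ^ K * (Real.Gamma u + Real.Gamma (A + v)) :=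
      mul_le_mul ((hpinv hab).trans (hraise (by rw [hK]; omega))) hΓ2 hΓab0 (by positivity)
    have hT10 : 0 ≤ (1 / p) ^ (a + b + 1) * Real.Gamma (a + b + 1) := mul_nonneg (by positivity) hΓab0
    calc _ ≤ (2 : ℝ) ^ a * ((1 / p) ^ (a + b + 1) * Real.Gamma (a + b + 1) + (2 * t) ^ a * ((1 / p) ^ (b + 1) * Real.Gamma (b + 1))) :=
          norm_jIntegral_le_of_nonneg hp ht ha0 hb1
      _ ≤ (2 : ℝ) ^ ⌈A⌉₊ * ((1 / p) ^ (a + b + 1) * Real.Gamma (a + b + 1) + (2 * t) ^ a * ((1 / p) ^ (b + 1) * Real.Gamma (b + 1))) :=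
          mul_le_mul_of_nonneg_right h2a (add_nonneg hT10 (mul_nonneg (Real.rpow_nonneg (by positivity) a) (mul_nonneg (by positivity) hΓb0)))
      _ = (2 : ℝ) ^ ⌈A⌉₊ * ((1 / p) ^ (a + b + 1) * Real.Gamma (a + b + 1)) + (2 : ℝ) ^ ⌈A⌉₊ * ((2 * t) ^ a * ((1 / p) ^ (b + 1) * Real.Gamma (b + 1))) := by ring
      _ ≤ (2 : ℝ) ^ ⌈A⌉₊ * ((Fp * Ft) ^ K * (Real.Gamma u + Real.Gamma (A + v))) + ((4 : ℝ) ^ ⌈A⌉₊ * (Real.Gamma u + Real.Gamma v)) * (Fp * Ft) ^ K :=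
          add_le_add (mul_le_mul_of_nonneg_left hT1 (by positivity)) hT2
      _ = _ := by ring
  · -- branch `re α ≤ 2`
    calc _ ≤ (2 * t) ^ a * ((1 / p) ^ (b + 1) * Real.Gamma (b + 1)) := norm_jIntegral_le_of_nonpos hp ht ha0.le hb1
      _ ≤ ((4 : ℝ) ^ ⌈A⌉₊ * (Real.Gamma u + Real.Gamma v)) * (Fp * Ft) ^ K := hT2'
      _ ≤ _ := by
          rw [add_mul]
          exact le_add_of_nonneg_left (by positivity)

/-! ## §3 The witness: unrolling the recursion to the half-plane of the integral representation -/

/-- **GROWTH OF ANY WITNESS, by the unrolling depth** (`j ≤ N`): on `{1 − j < re(β₁+z)}` the letters (b) (at `β₁ + j`) and (c) (recursion, `j` times) bound `Φ α₀ β₁ p s` near `z` by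
`C·E(p,t)^K`, `C K r` depending on `(α₀, β₁, z, j)` only. [cite: Shimura1982, §3 Thm. 3.1] -/
theorem norm_witness_le_aux {t : ℝ} (ht : 0 < t) {N : ℕ} (Φ : ℂ → ℂ → ℝ → ℂ → ℂ)
    (hΦb : ∀ (α₀ β₀ : ℂ) (p : ℝ), 0 < p → ∀ s : ℂ, 1 < (β₀ + s).re → Φ α₀ β₀ p s = (Complex.Gamma (β₀ + s - 1))⁻¹ *
      ∫ r in Ioi (0 : ℝ), cexp (-((p * r : ℝ) : ℂ)) * ((((r + 2 * t : ℝ)) : ℂ) ^ (α₀ + s - 2) * ((r : ℝ) : ℂ) ^ (β₀ + s - 2)))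
    (hΦc : ∀ (α₀ β₀ : ℂ) (p : ℝ), 0 < p → ∀ s : ℂ, 1 - N < (β₀ + s).re →
      Φ α₀ β₀ p s = (p : ℂ) * Φ α₀ (β₀ + 1) p s - (α₀ + s - 2) * Φ (α₀ - 1) (β₀ + 1) p s) :
    ∀ j : ℕ, j ≤ N → ∀ (α₀ β₁ z : ℂ), 1 - (j : ℝ) < (β₁ + z).re →
      ∃ (K : ℕ) (C r : ℝ), 0 ≤ C ∧ 0 < r ∧ ∀ p : ℝ, 0 < p → ∀ s : ℂ, dist s z < r →
        ‖Φ α₀ β₁ p s‖ ≤ C * (((1 + p) * (1 + p⁻¹)) * ((1 + t) * (1 + t⁻¹))) ^ K := by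
  intro j
  induction j with
  | zero =>
    intro _ α₀ β₁ z hz
    simp only [Nat.cast_zero, sub_zero] at hz
    -- the ball: radius `r ≤ 1`, `r ≤ (re(β₁+z) − 1)/2`
    set r : ℝ := min ((( β₁ + z).re - 1) / 2) 1 with hr
    have hr0 : 0 < r := lt_min (by linarith) one_pos
    have hr1 : r ≤ 1 := min_le_right _ _
    have hr2 : r ≤ ((β₁ + z).re - 1) / 2 := min_le_left _ _
    -- `Γ(β₁+s−1)⁻¹` is entire, hence bounded on the closed ball
    have hcont : ContinuousOn (fun s : ℂ => (Complex.Gamma (β₁ + s - 1))⁻¹) (closedBall z r) :=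
      ((Complex.differentiable_one_div_Gamma.comp (((differentiable_id).const_add β₁).sub_const 1)).continuous).continuousOn
    obtain ⟨CΓ, hCΓ⟩ := (isCompact_closedBall z r).exists_bound_of_continuousOn hcont
    have hCΓ0 : 0 ≤ CΓ := (norm_nonneg _).trans (hCΓ z (mem_closedBall_self hr0.le))
    -- the envelope constants
    set A : ℝ := |(α₀ + z - 2).re| + 1 with hAdef
    set u : ℝ := ((β₁ + z).re - 1) / 2 with hudef
    set v : ℝ := (β₁ + z).re with hvdef
    have hu : 0 < u := by rw [hudef]; linarith
    set CJ : ℝ := (2 : ℝ) ^ ⌈A⌉₊ * (Real.Gamma u + Real.Gamma (A + v)) + (4 : ℝ) ^ ⌈A⌉₊ * (Real.Gamma u + Real.Gamma v) with hCJ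
    have hA0 : 0 ≤ A := by positivity
    have hCJ0 : 0 ≤ CJ := by
      have := (Real.Gamma_pos_of_pos hu).le
      have := (Real.Gamma_pos_of_pos (hu.trans_le (by rw [hudef, hvdef]; linarith) : 0 < v)).le
      have := (Real.Gamma_pos_of_pos (by linarith : 0 < A + v)).le
      positivity
    refine ⟨⌈A + v⌉₊ + ⌈A⌉₊ + ⌈v⌉₊, CΓ * CJ, r, mul_nonneg hCΓ0 hCJ0, hr0, fun p hp s hs => ?_⟩
    have hsz : ‖s - z‖ < r := by rwa [← dist_eq_norm]
    have hre : |(s - z).re| < r := (abs_re_le_norm _).trans_lt hsz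
    have hre' := abs_lt.1 hre
    have hs1 : 1 < (β₁ + s).re := by
      have : (β₁ + s).re = (β₁ + z).re + (s - z).re := by simp only [add_re, sub_re]; ring
      rw [this]; linarith
    rw [hΦb α₀ β₁ p hp s hs1, norm_mul, mul_assoc]
    refine mul_le_mul (hCΓ s (mem_closedBall.2 hs.le)) (norm_jIntegral_le_env hp ht ?_ hu ?_ ?_) (norm_nonneg _) hCΓ0
    · -- `|re(α₀+s−2)| ≤ |re(α₀+z−2)| + 1`
      have : (α₀ + s - 2).re = (α₀ + z - 2).re + (s - z).re := by simp only [add_re, sub_re]; ring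
      rw [this]
      exact (abs_add_le _ _).trans (by linarith [le_of_lt hre])
    · have : (β₁ + s - 2).re + 1 = (β₁ + z).re - 1 + (s - z).re := by simp only [add_re, sub_re, re_ofNat]; ring
      rw [this, hudef]; linarith
    · have : (β₁ + s - 2).re + 1 = (β₁ + z).re - 1 + (s - z).re := by simp only [add_re, sub_re, re_ofNat]; ring
      rw [this, hvdef]; linarith
  | succ j ih =>
    intro hj α₀ β₁ z hz
    have hjN : j ≤ N := Nat.le_of_succ_le hj
    have hz1 : 1 - (j : ℝ) < (β₁ + 1 + z).re := by
      simp only [Nat.cast_succ, add_re, one_re] at hz ⊢; linarith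
    obtain ⟨K₁, C₁, r₁, hC₁, hr₁, hB₁⟩ := ih hjN α₀ (β₁ + 1) z hz1
    obtain ⟨K₂, C₂, r₂, hC₂, hr₂, hB₂⟩ := ih hjN (α₀ - 1) (β₁ + 1) z hz1
    -- margin for the recursion: `re(β₁+z) − (1 − N) > 0`
    have hmargin : 0 < (β₁ + z).re - (1 - N) := by
      have : (j : ℝ) + 1 ≤ N := by exact_mod_cast hj
      simp only [Nat.cast_succ] at hz; linarith
    set r : ℝ := min (min r₁ r₂) (min 1 (((β₁ + z).re - (1 - N)) / 2)) with hr
    have hr0 : 0 < r := lt_min (lt_min hr₁ hr₂) (lt_min one_pos (by linarith))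
    refine ⟨K₁ + K₂ + 1, C₁ + (‖α₀‖ + ‖z‖ + 3) * C₂, r, by positivity, hr0, fun p hp s hs => ?_⟩
    have hs₁ : dist s z < r₁ := lt_of_lt_of_le hs ((min_le_left _ _).trans (min_le_left _ _))
    have hs₂ : dist s z < r₂ := lt_of_lt_of_le hs ((min_le_left _ _).trans (min_le_right _ _))
    have hs1 : dist s z < 1 := lt_of_lt_of_le hs ((min_le_right _ _).trans (min_le_left _ _))
    have hsm : dist s z < ((β₁ + z).re - (1 - N)) / 2 := lt_of_lt_of_le hs ((min_le_right _ _).trans (min_le_right _ _))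
    have hsz : ‖s - z‖ = dist s z := (dist_eq_norm _ _).symm
    have hre : |(s - z).re| ≤ dist s z := hsz ▸ abs_re_le_norm _
    have hsN : 1 - (N : ℝ) < (β₁ + s).re := by
      have : (β₁ + s).re = (β₁ + z).re + (s - z).re := by simp only [add_re, sub_re]; ring
      rw [this]; linarith [(abs_le.1 hre).1]
    -- the envelope and the two bounds
    set E : ℝ := ((1 + p) * (1 + p⁻¹)) * ((1 + t) * (1 + t⁻¹)) with hE
    have hE1 : 1 ≤ E := by
      have := one_le_envFactor hp; have := one_le_envFactor ht; rw [hE]; nlinarith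
    have hpE : 1 + p ≤ E := by
      rw [hE]
      calc 1 + p ≤ (1 + p) * (1 + p⁻¹) := le_mul_of_one_le_right (by linarith) (by linarith [inv_pos.2 hp])
        _ ≤ _ := le_mul_of_one_le_right (by nlinarith [inv_pos.2 hp]) (one_le_envFactor ht)
    have b1 := hB₁ p hp s hs₁
    have b2 := hB₂ p hp s hs₂
    have hcoef : ‖α₀ + s - 2‖ ≤ ‖α₀‖ + ‖z‖ + 3 := by
      have h1 : ‖s‖ ≤ ‖z‖ + 1 := by
        calc ‖s‖ = ‖z + (s - z)‖ := by congr 1; ring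
          _ ≤ ‖z‖ + ‖s - z‖ := norm_add_le _ _
          _ ≤ ‖z‖ + 1 := by rw [hsz]; linarith
      calc ‖α₀ + s - 2‖ ≤ ‖α₀ + s‖ + ‖(2 : ℂ)‖ := norm_sub_le _ _
        _ ≤ ‖α₀‖ + ‖s‖ + 2 := by rw [Complex.norm_ofNat]; linarith [norm_add_le α₀ s]
        _ ≤ _ := by linarith
    have hK1 : E ^ K₁ * E ≤ E ^ (K₁ + K₂ + 1) := by
      rw [← pow_succ]; exact pow_le_pow_right₀ hE1 (by omega)
    have hK2 : E ^ K₂ ≤ E ^ (K₁ + K₂ + 1) := pow_le_pow_right₀ hE1 (by omega)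
    rw [hΦc α₀ β₁ p hp s hsN]
    calc ‖(p : ℂ) * Φ α₀ (β₁ + 1) p s - (α₀ + s - 2) * Φ (α₀ - 1) (β₁ + 1) p s‖
        ≤ ‖(p : ℂ) * Φ α₀ (β₁ + 1) p s‖ + ‖(α₀ + s - 2) * Φ (α₀ - 1) (β₁ + 1) p s‖ := norm_sub_le _ _
      _ ≤ (1 + p) * (C₁ * E ^ K₁) + (‖α₀‖ + ‖z‖ + 3) * (C₂ * E ^ K₂) := by
          rw [norm_mul, norm_mul, Complex.norm_real, Real.norm_of_nonneg hp.le]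
          exact add_le_add (mul_le_mul (by linarith) b1 (norm_nonneg _) (by linarith)) (mul_le_mul hcoef b2 (norm_nonneg _) (by positivity))
      _ ≤ E * (C₁ * E ^ K₁) + (‖α₀‖ + ‖z‖ + 3) * (C₂ * E ^ K₂) := by
          have : 0 ≤ C₁ * E ^ K₁ := by positivity
          nlinarith
      _ = C₁ * (E ^ K₁ * E) + (‖α₀‖ + ‖z‖ + 3) * C₂ * E ^ K₂ := by ring
      _ ≤ C₁ * E ^ (K₁ + K₂ + 1) + (‖α₀‖ + ‖z‖ + 3) * C₂ * E ^ (K₁ + K₂ + 1) :=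
          add_le_add (mul_le_mul_of_nonneg_left hK1 hC₁) (mul_le_mul_of_nonneg_left hK2 (by positivity))
      _ = (C₁ + (‖α₀‖ + ‖z‖ + 3) * C₂) * E ^ (K₁ + K₂ + 1) := by ring

/-- **GROWTH OF THE UNIVERSAL WITNESS** (depth `N`, letters (b)(c) of ★ p863550 BY VALUE): near every `z` with `1 − N < re(β₀+z)` there are `K C r` (depending on `(α₀, β₀, z, N)`
only) with `‖Φ α₀ β₀ p s‖ ≤ C·((1+p)(1+p⁻¹)(1+t)(1+t⁻¹))^K` for all `p > 0` and `dist s z < r`. [cite: Shimura1982, §3 Thm. 3.1] [cite: Shimura1997, §16.4] -/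
theorem norm_witness_le {t : ℝ} (ht : 0 < t) {N : ℕ} (Φ : ℂ → ℂ → ℝ → ℂ → ℂ)
    (hΦb : ∀ (α₀ β₀ : ℂ) (p : ℝ), 0 < p → ∀ s : ℂ, 1 < (β₀ + s).re → Φ α₀ β₀ p s = (Complex.Gamma (β₀ + s - 1))⁻¹ *
      ∫ r in Ioi (0 : ℝ), cexp (-((p * r : ℝ) : ℂ)) * ((((r + 2 * t : ℝ)) : ℂ) ^ (α₀ + s - 2) * ((r : ℝ) : ℂ) ^ (β₀ + s - 2)))
    (hΦc : ∀ (α₀ β₀ : ℂ) (p : ℝ), 0 < p → ∀ s : ℂ, 1 - N < (β₀ + s).re →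
      Φ α₀ β₀ p s = (p : ℂ) * Φ α₀ (β₀ + 1) p s - (α₀ + s - 2) * Φ (α₀ - 1) (β₀ + 1) p s)
    (α₀ β₀ z : ℂ) (hz : 1 - (N : ℝ) < (β₀ + z).re) :
    ∃ (K : ℕ) (C r : ℝ), 0 ≤ C ∧ 0 < r ∧ ∀ p : ℝ, 0 < p → ∀ s : ℂ, dist s z < r →
      ‖Φ α₀ β₀ p s‖ ≤ C * (((1 + p) * (1 + p⁻¹)) * ((1 + t) * (1 + t⁻¹))) ^ K :=
  norm_witness_le_aux ht Φ hΦb hΦc N le_rfl α₀ β₀ z hz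

end Summit.HodgeConjecture.HodgeConjecture.Cruxes.HLiu418.K2LiuHermTwoEtaRankOneWitnessGrowth

end
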